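import Mathlib.Data.Nat.Pairing
import Literature.Computability.Complexity.CNF
import Literature.Computability.Complexity.Circuit
import Literature.Computability.Complexity.ProofComplexity
import Literature.Computability.MetaComplexity.TruthTables
import HarnessLib

/-!
# Truth-table tautologies `tt(s, n, f)` — Razborov's CNF `Circuit_{s,n}(f, q)`

Definition request `defn-ttFormula` (decomp-pnenp cell, TREE debt D18): the propositional formula
expressing the circuit lower bound «no `B₂`-circuit with `s` gates computes the Boolean function
`f : {0,1}ⁿ → {0,1}`», with the truth table of `f` hard-wired (Razborov 1996, §5: the CNF
`Circuit_{t,n}(f_n, q)` in the "description" variables `q` of a size-`t` circuit together with its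
gate values on all `2ⁿ` rows; Krajíček 2019, §19.5 p. 425, the `τ`-formulas `τ(tt_{s,k})_b`;
Pich–Santhanam 2023, §1.1.2, `tt(f, s)`).  The encoding below is the one registered on the hub for
crux `stmt-PneNP-18211` (`Summits/PneNP/PneNP/Cruxes/HardnessTransfer/Lines/birth.lean`, namespace
`…Birth.TT`, 2026-08-17), copied symbol-for-symbol so that the dedup bridge is `rfl` once both build.

We provide

* the variable layout `v`, `opV`, `selV`, `outV`, `inV`, `gateV`, `argV`, `resV`, `srcV` (a tag and
  three indices packed by `Nat.pair`);
* the clause families `selClauses`, `inputClauses`, `argClauses`, `gateClauses`, `outClauses`,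
  `targetClauses`, their conjunction `circuitCNF s n f : CNF ℕ` (= `Circuit_{s,n}(f, q)`), the
  requested name `ttFormula n s f := circuitCNF s n f`, and the tautology
  `ttForm s n f := ¬ ofCNF (circuitCNF s n f) : PropForm ℕ`;
* the semantics: `ttForm_isTautology_iff` (tautology ↔ the CNF is unsatisfiable, proved from the
  tree's `isTautology_neg_ofCNF_iff`); the correctness of the encoding as the named fact
  `circuitCNF_satisfiable_iff` (for `0 < n`: satisfiable ↔ some circuit over `B2` with at most `s`
  gates computes `f`) — the ONE named fact of this file — and, derived from it, the direction used by
  the routes `ttForm_isTautology_of_lt_circuitSizeOver` (all `n`; = the statement of the registered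
  stub `stub_ttTautOfHard` of crux 18211 made conditional on the fact), the edge case
  `ttForm_zero_isTautology`, the converse `lt_circuitSizeOver_of_isTautology` and `ttForm_isTautology_iff_lt`;
* clause counts of the row-indexed families (`length_targetClauses`, `length_inputClauses`).

Edge cases (documented, not hidden): for `n = 0` gate `0` has no admissible source, so
`selClauses s 0` contains the empty clause whenever `s ≥ 1` or (output clause) always — `ttForm s 0 f`
is then a tautology although the one-gate constant circuit computes `f`; hence the `↔`-fact assumes
`0 < n`, while the `→`-direction `s < circuitSizeOver B2 f → tautology` holds for every `n`.  A gate of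
fan-in `≤ 1` (allowed in the tree's `B2 = {g | g.1 ≤ 2}`) is simulated by a binary op-table ignoring an
argument; a circuit with fewer than `s` gates is padded with dummy gates (both need a source, i.e.
`0 < n`).

References: A. A. Razborov, *Lower bounds for propositional proofs and independence results in
bounded arithmetic*, ICALP 1996, LNCS 1099, 48–62, §5 (p. 62: `Circuit_{t,n}(f_n, q)`;
`NP ⊄ P/poly ⟺ ¬Circuit_{t(n),n}(s_n, q)` tautologies); J. Krajíček, *Proof complexity*, CUP 2019,
§19.5 (pp. 425–427); J. Pich, R. Santhanam, *Towards P ≠ NP from extended Frege lower bounds*,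
arXiv:2312.08163, §1.1.2.
-/

namespace Literature.Computability.MetaComplexity

open Literature.Computability.Complexity

namespace TT

/-! ## §1 Variable layout -/

/-- Variable layout: a tag and three indices, packed injectively into `ℕ` by `Nat.pair`
(Razborov 1996, §5 p. 62: the variables `q` (description) and the evaluation variables).
[cite: Razborov1996ICALP, §5 p. 62] -/
def v (tag a b c : ℕ) : ℕ := Nat.pair tag (Nat.pair a (Nat.pair b c))

/-- `opV j a b` — the op-table bit of gate `j` at argument values `(a, b)` (description variable).
[cite: Razborov1996ICALP, §5 p. 62] -/
def opV (j : ℕ) (a b : Bool) : ℕ := v 0 j (cond a 1 0) (cond b 1 0)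

/-- `selV j k w` — argument `k < 2` of gate `j` is wired to source `w < n + j` (description variable).
[cite: Razborov1996ICALP, §5 p. 62] -/
def selV (j k w : ℕ) : ℕ := v 1 j k w

/-- `outV w` — the output wire is source `w < n + s` (description variable).
[cite: Razborov1996ICALP, §5 p. 62] -/
def outV (w : ℕ) : ℕ := v 2 w 0 0

/-- `inV x i` — the value of input `i` on row `x`. [cite: Razborov1996ICALP, §5 p. 62] -/
def inV (x i : ℕ) : ℕ := v 3 x i 0

/-- `gateV x j` — the value of gate `j` on row `x`. [cite: Razborov1996ICALP, §5 p. 62] -/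
def gateV (x j : ℕ) : ℕ := v 4 x j 0

/-- `argV x j k` — the value of argument `k` of gate `j` on row `x`. [cite: Razborov1996ICALP, §5 p. 62] -/
def argV (x j k : ℕ) : ℕ := v 5 x j k

/-- `resV x` — the value of the output wire on row `x`. [cite: Razborov1996ICALP, §5 p. 62] -/
def resV (x : ℕ) : ℕ := v 6 x 0 0

/-- The value variable of source `w` on row `x`: input `w` if `w < n`, else gate `w - n`.
[cite: Razborov1996ICALP, §5 p. 62] -/
def srcV (n x w : ℕ) : ℕ := if w < n then inV x w else gateV x (w - n)

/-- The packing `v` is injective in all four coordinates (from `Nat.pair` injectivity).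
[cite: Razborov1996ICALP, §5 p. 62] -/
theorem v_injective {t a b c t' a' b' c' : ℕ} (h : v t a b c = v t' a' b' c') :
    t = t' ∧ a = a' ∧ b = b' ∧ c = c' := by
  unfold v at h
  have h1 := Nat.pair_eq_pair.1 h
  have h2 := Nat.pair_eq_pair.1 h1.2
  have h3 := Nat.pair_eq_pair.1 h2.2
  exact ⟨h1.1, h2.1, h3.1, h3.2⟩

/-! ## §2 The clause families, `Circuit_{s,n}(f, q)` and `tt(s, n, f)` -/

/-- Selector clauses: every argument of every gate selects at least one admissible source, and the
output selects at least one source. [cite: Razborov1996ICALP, §5 p. 62] -/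
def selClauses (s n : ℕ) : CNF ℕ :=
  ((List.range s).flatMap fun j => (List.range 2).map fun k =>
      (List.range (n + j)).map fun w => (selV j k w, true)) ++
    [(List.range (n + s)).map fun w => (outV w, true)]

/-- Input clauses: on row `x` input `i` carries bit `i` of `x` (unit clauses).
[cite: Razborov1996ICALP, §5 p. 62] -/
def inputClauses (n : ℕ) : CNF ℕ :=
  (List.finRange (2 ^ n)).flatMap fun x =>
    (List.finRange n).map fun i => [(inV x.1 i.1, (boolFunEquivFin n).symm x i)]

/-- Wiring clauses: a selected source's value is copied to the argument, on every row.
[cite: Razborov1996ICALP, §5 p. 62] -/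
def argClauses (s n : ℕ) : CNF ℕ :=
  (List.range (2 ^ n)).flatMap fun x => (List.range s).flatMap fun j =>
    (List.range 2).flatMap fun k => (List.range (n + j)).flatMap fun w =>
      [[(selV j k w, false), (argV x j k, false), (srcV n x w, true)],
        [(selV j k w, false), (argV x j k, true), (srcV n x w, false)]]

/-- Gate clauses: the gate value is the op-table entry at the argument values, on every row.
[cite: Razborov1996ICALP, §5 p. 62] -/
def gateClauses (s n : ℕ) : CNF ℕ :=
  (List.range (2 ^ n)).flatMap fun x => (List.range s).flatMap fun j =>
    [false, true].flatMap fun a => [false, true].flatMap fun b =>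
      [[(argV x j 0, !a), (argV x j 1, !b), (gateV x j, false), (opV j a b, true)],
        [(argV x j 0, !a), (argV x j 1, !b), (gateV x j, true), (opV j a b, false)]]

/-- Output clauses: the selected output source's value is the result, on every row.
[cite: Razborov1996ICALP, §5 p. 62] -/
def outClauses (s n : ℕ) : CNF ℕ :=
  (List.range (2 ^ n)).flatMap fun x => (List.range (n + s)).flatMap fun w =>
    [[(outV w, false), (resV x, false), (srcV n x w, true)],
      [(outV w, false), (resV x, true), (srcV n x w, false)]]

/-- Target clauses: the truth table of `f` hard-wired as the result (unit clauses).
[cite: Razborov1996ICALP, §5 p. 62] [cite: PichSanthanam2023, §1.1.2] -/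
def targetClauses (n : ℕ) (f : (Fin n → Bool) → Bool) : CNF ℕ :=
  (List.finRange (2 ^ n)).map fun x => [(resV x.1, f ((boolFunEquivFin n).symm x))]

/-- **Razborov's CNF `Circuit_{s,n}(f, q)`**: «the description `q` is a `B₂`-circuit with `s` gates
whose evaluation on all `2ⁿ` rows agrees with `f`». [cite: Razborov1996ICALP, §5 p. 62]
[cite: KrajicekProofComplexity2019, §19.5 p. 425] -/
def circuitCNF (s n : ℕ) (f : (Fin n → Bool) → Bool) : CNF ℕ :=
  selClauses s n ++ inputClauses n ++ argClauses s n ++ gateClauses s n ++ outClauses s n ++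
    targetClauses n f

/-- **The truth-table tautology `tt(s, n, f) := ¬ Circuit_{s,n}(f, q)`** — «no `B₂`-circuit with `s`
gates computes `f`». [cite: Razborov1996ICALP, §5 p. 62] [cite: KrajicekProofComplexity2019, §19.5 p. 425]
[cite: PichSanthanam2023, §1.1.2] -/
def ttForm (s n : ℕ) (f : (Fin n → Bool) → Bool) : PropForm ℕ :=
  PropForm.neg (PropForm.ofCNF (circuitCNF s n f))

end TT

/-- The requested name of `defn-ttFormula`: `ttFormula n s h` is the CNF `Circuit_{s,n}(h, q)` (argument
order of the request: inputs, size, function). [cite: Razborov1996ICALP, §5 p. 62] -/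
def ttFormula (n s : ℕ) (h : (Fin n → Bool) → Bool) : CNF ℕ := TT.circuitCNF s n h

/-- `ttFormula` is `TT.circuitCNF` with the arguments reordered. [cite: Razborov1996ICALP, §5 p. 62] -/
theorem ttFormula_eq (n s : ℕ) (h : (Fin n → Bool) → Bool) : ttFormula n s h = TT.circuitCNF s n h := rfl

/-! ## §3 Semantics -/

/-- `tt(s, n, f)` is a tautology iff `Circuit_{s,n}(f, q)` is unsatisfiable (the tree's
`isTautology_neg_ofCNF_iff`). [cite: Razborov1996ICALP, §5 p. 62] -/
theorem ttForm_isTautology_iff (s n : ℕ) (f : (Fin n → Bool) → Bool) :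
    (TT.ttForm s n f).IsTautology ↔ ¬ (TT.circuitCNF s n f).Satisfiable :=
  isTautology_neg_ofCNF_iff _

/-- **Correctness of the encoding** (named fact; the routine construction in both directions is owed —
its `→` half is the registered stub `stub_ttTautOfHard` of crux `stmt-PneNP-18211`): for `0 < n`,
`Circuit_{s,n}(f, q)` is satisfiable iff some circuit over `B2` with at most `s` gates computes `f`
(forward: read the gates off the selector/op-table bits, values certified row by row by the wiring/gate/
output clauses; backward: binary op-tables simulate fan-in `≤ 2`, pad with dummy gates to exactly `s`).
[cite: Razborov1996ICALP, §5 p. 62] [cite: KrajicekProofComplexity2019, §19.5 p. 425] -/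
def circuitCNF_satisfiable_iff : Prop :=
  ∀ (s n : ℕ) (f : (Fin n → Bool) → Bool), 0 < n →
    ((TT.circuitCNF s n f).Satisfiable ↔
      ∃ C : Circuit (Fin n), C.IsOver B2 ∧ C.Computes f ∧ C.size ≤ s)

/-- From the correctness fact: `s < circuitSizeOver B2 f → tt(s, n, f)` is a tautology (`0 < n`).
[cite: Razborov1996ICALP, §5 p. 62] -/
theorem ttForm_isTautology_of_lt (hc : circuitCNF_satisfiable_iff) {s n : ℕ} (hn : 0 < n)
    (f : (Fin n → Bool) → Bool) (hs : s < circuitSizeOver B2 f) : (TT.ttForm s n f).IsTautology := by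
  rw [ttForm_isTautology_iff]
  intro hsat
  obtain ⟨C, hB, hf, hsize⟩ := (hc s n f hn).1 hsat
  exact absurd (lt_of_lt_of_le hs ((circuitSizeOver_le_of_computes C hB hf).trans hsize)) (lt_irrefl _)

/-- The documented edge case `n = 0`: gate `0`'s selector clause ranges over `n + 0 = 0` sources and the
output selector over `n + s = s` sources, so `Circuit_{s,0}(f, q)` contains the empty clause for every
`s` (gate `0` if `s ≥ 1`, the output if `s = 0`) — `tt(s, 0, f)` is a tautology outright, although the
one-gate constant circuit computes `f`. [cite: Razborov1996ICALP, §5 p. 62] -/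
theorem ttForm_zero_isTautology (s : ℕ) (f : (Fin 0 → Bool) → Bool) : (TT.ttForm s 0 f).IsTautology := by
  rw [ttForm_isTautology_iff]
  apply CNF.not_satisfiable_of_nil_mem
  have hsel : ([] : Clause ℕ) ∈ TT.selClauses s 0 := by
    unfold TT.selClauses
    rcases Nat.eq_zero_or_pos s with rfl | hs
    · simp
    · exact List.mem_append.2 (Or.inl (List.mem_flatMap.2 ⟨0, List.mem_range.2 hs, by simp⟩))
  simp [TT.circuitCNF, hsel]

/-- **The direction the routes use**, for every `n` (= the statement of the registered stub
`stub_ttTautOfHard` of crux `stmt-PneNP-18211`, up to namespace), derived from the correctness fact: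
if no `B₂`-circuit with `≤ s` gates computes `f`, i.e. `s < circuitSizeOver B2 f`, then `tt(s, n, f)` is
a tautology. [cite: Razborov1996ICALP, §5 p. 62] [cite: PichSanthanam2023, §1.1.2] -/
theorem ttForm_isTautology_of_lt_circuitSizeOver (hc : circuitCNF_satisfiable_iff) (s n : ℕ)
    (f : (Fin n → Bool) → Bool) (hs : s < circuitSizeOver B2 f) : (TT.ttForm s n f).IsTautology := by
  rcases Nat.eq_zero_or_pos n with rfl | hn
  · exact ttForm_zero_isTautology s f
  · exact ttForm_isTautology_of_lt hc hn f hs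

/-- From the correctness fact and the attainment of `circuitSizeOver B2` (tree fact
`exists_computes_B2_size_eq`): if `tt(s, n, f)` is a tautology then `s < circuitSizeOver B2 f` (`0 < n`).
[cite: Razborov1996ICALP, §5 p. 62] -/
theorem lt_circuitSizeOver_of_isTautology (hc : circuitCNF_satisfiable_iff) {s n : ℕ} (hn : 0 < n)
    (hB2 : exists_computes_B2_size_eq (n := n)) (f : (Fin n → Bool) → Bool)
    (ht : (TT.ttForm s n f).IsTautology) : s < circuitSizeOver B2 f := by
  rw [ttForm_isTautology_iff] at ht
  by_contra hle
  obtain ⟨C, hB, hf, hsize⟩ := hB2 f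
  exact ht ((hc s n f hn).2 ⟨C, hB, hf, hsize ▸ not_lt.1 hle⟩)

/-- Hence, modulo the correctness fact and the tree fact `exists_computes_B2_size_eq`, `tt(s, n, f)` is
a tautology EXACTLY when `s < circuitSizeOver B2 f` (`0 < n`): the truth-table tautologies are the TRUE
circuit lower bounds. [cite: Razborov1996ICALP, §5 p. 62] [cite: KrajicekProofComplexity2019, §19.5 p. 425] -/
theorem ttForm_isTautology_iff_lt (hc : circuitCNF_satisfiable_iff) {s n : ℕ} (hn : 0 < n)
    (hB2 : exists_computes_B2_size_eq (n := n)) (f : (Fin n → Bool) → Bool) :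
    (TT.ttForm s n f).IsTautology ↔ s < circuitSizeOver B2 f :=
  ⟨lt_circuitSizeOver_of_isTautology hc hn hB2 f, ttForm_isTautology_of_lt hc hn f⟩

/-! ## §4 Clause counts of the row-indexed unit families -/

/-- `targetClauses n f` has exactly `2 ^ n` (unit) clauses. [cite: Razborov1996ICALP, §5 p. 62] -/
theorem length_targetClauses (n : ℕ) (f : (Fin n → Bool) → Bool) :
    (TT.targetClauses n f).length = 2 ^ n := by
  simp [TT.targetClauses]

/-- `inputClauses n` has exactly `2 ^ n * n` (unit) clauses. [cite: Razborov1996ICALP, §5 p. 62] -/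
theorem length_inputClauses (n : ℕ) : (TT.inputClauses n).length = 2 ^ n * n := by
  simp [TT.inputClauses, List.length_flatMap]

end Literature.Computability.MetaComplexity
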